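import Summits.Ventures.CertifiedManyBodySolver.Downfold.TppSeamFilling
import Literature.MathematicalPhysics.QuantumLattice.HubbardTTPrimeTPPDoublingUAnchors
import Literature.MathematicalPhysics.QuantumLattice.HubbardTTPrimeBoxWordExtension
import HarnessLib

/-!
# The `t''` seam at fixed filling, `U`-DRESSED edition: an object-M energy word whose `t''` allowance is
# `m·|ℓ_V|` (a certified `t' = 0` row at coupling `V`) instead of the kinematic `(16/π²)·m`

Venture CertifiedManyBodySolver, stage S1 ↔ S2 seam (cell `pub/hubbard-downfold`'s grammar: `OneBandBox`, `Entry`,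
`HoldsOn`, `s2Lo/s2Hi`); ADAPTER contributed by the S2 seat `hubbard-box-p3` (cell `pub/hubbard-fast`, 2026-08-28) for
the Literature law `HubbardTTPrimeTPPDoublingUAnchors` (p591420): the doubling map `x ↦ 2x` reads the pure-`t''` Hubbard
interaction WITH its repulsion as the nearest-neighbour one, so

* FLOOR (`holdsOn_tpp_floor_of_anchorCell_diagU`): an S2 FLOOR `L` on a SOURCE CELL `Set.Icc ![U₁',s₁',n₁'] ![U₂',s₂',n₂']` (coordinates
  `(U/t, tp/t, n)`, the `_word_Icc` shape) whose `U`-range contains an anchor column `U_a ≥ 0` with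
  `U_a + m·V ≤ eU.lo` (`m = max |eSS.lo| |eSS.hi|`, `V ≥ 0`) and whose `tp`, `n` ranges cover the box's entries, plus a
  NON-POSITIVE `t' = 0` row `ℓ ≤ e(1, 0, V, n)` valid at every filling of the box, give `L + m·ℓ ≤ e^M_n(p)` on the box —
  the kinematic edition's `L − (16/π²)·m` with `16/π² = 1.62` replaced by `|ℓ_V|` (`0.83` at `(V, n) = (8, 7/8)`, `0.55 / 0.39`
  at `(8 | 12, 1)`), at the price of reading the `t–t'` floor on the LOWER column `U_a` instead of the box's own cell;
* CAP (`holdsOn_tpp_cap_of_docc_diagU`): the box's OWN S2 cap `R` (as in `holdsOn_tiGroundEnergyDensityAt_objectM_kinematic`)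
  plus a double-occupancy ceiling `D` for every torus-limit ground state of the box's cell (the `docc` word shape) and a
  row `ℓ' ≤ e(1, 0, V', n)` give `e^M_n(p) ≤ R + m·(V'·D − ℓ')`;
* both sides `holdsOn_tpp_window_diagU`.

Everything is PROVED; no definition, no number. HONEST FRAMING: energy bookkeeping for the `t''` truncation of object M;
inputs are S2 words / registry rows / docc words BY HYPOTHESIS exactly as in the kinematic seam; nothing here is an order,
pairing or `T_c` statement, and no material number is certified by this file.
-/

noncomputable section

namespace Summit.Ventures.CertifiedManyBodySolver.Downfold

open NonemptyInterval Literature.MathematicalPhysics.QuantumLattice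
  Literature.MathematicalPhysics.QuantumLattice.ThermodynamicLimit Literature.Probability.LatticeModels
open Matrix HubbardWave0 _root_.Filter
open scoped _root_.Topology

/-- Coordinates of a member: `eU.lo ≤ U/t`, `tp/t ∈ [eS.lo, eS.hi]`, `n ∈ [eN.lo, eN.hi]`, `|tpp/t| ≤ max |eSS.lo| |eSS.hi|`
(real casts of the rational end points). [folklore] -/
theorem mem_coords_of_mem {B : OneBandBox} {eU eS eSS eN : Entry} (hU : B .UOverT = some eU)
    (hS : B .tpOverT = some eS) (hSS : B .tppOverT = some eSS) (hN : B .filling = some eN)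
    {p : OneBandCoord → ℝ} (hp : B.Mem p) :
    ((eU.encl.fst : ℚ) : ℝ) ≤ p .UOverT ∧ p .UOverT ≤ ((eU.encl.snd : ℚ) : ℝ) ∧
      ((eS.encl.fst : ℚ) : ℝ) ≤ p .tpOverT ∧ p .tpOverT ≤ ((eS.encl.snd : ℚ) : ℝ) ∧
      ((eN.encl.fst : ℚ) : ℝ) ≤ p .filling ∧ p .filling ≤ ((eN.encl.snd : ℚ) : ℝ) ∧
      |p .tppOverT| ≤ ((max |eSS.encl.fst| |eSS.encl.snd| : ℚ) : ℝ) := by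
  have hu := mem_ratCast_iff.1 (hp _ _ hU)
  have hs := mem_ratCast_iff.1 (hp _ _ hS)
  have hn := mem_ratCast_iff.1 (hp _ _ hN)
  exact ⟨hu.1, hu.2, hs.1, hs.2, hn.1, hn.2, Entry.abs_le_of_mem (hp _ _ hSS)⟩

/-- **THE DRESSED `t''` FLOOR SEAM.** Let `B` carry entries `eU, eS, eSS, eN` (`U/t`, `tp/t`, `tpp/t`, `n`) with
`0 < eN.lo`, `eN.hi < 2`, and `m = max |eSS.lo| |eSS.hi|`. Let an S2 FLOOR `L` hold on a source cell `Set.Icc ![U₁',s₁',n₁'] ![U₂',s₂',n₂']`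
(coordinates `(U/t, tp/t, n)`, the `cw_…_word_Icc` shape), whose `U`-range contains an anchor column `U_a ≥ 0`
(`U₁' ≤ U_a ≤ U₂'`) with `U_a + m·V ≤ eU.lo` (`V ≥ 0`), and whose `tp` and `n` ranges cover the
box's entries; and let `ℓ ≤ 0` be a `t' = 0` row `ℓ ≤ e(1, 0, V, n)` at every filling `n` of the box. Then on `B`:
`L + m·ℓ ≤ e_{p n}(1, p tp/t, p tpp/t, p U/t)`. [cite: Ruelle1969, §3.4] -/
theorem holdsOn_tpp_floor_of_anchorCell_diagU {B : OneBandBox} {eU eS eSS eN : Entry}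
    (hU : B .UOverT = some eU) (hS : B .tpOverT = some eS) (hSS : B .tppOverT = some eSS)
    (hN : B .filling = some eN) (hN0 : 0 < eN.encl.fst) (hN2 : eN.encl.snd < 2)
    {Ulo' slo' nlo' Uhi' shi' nhi' L : ℝ}
    (hL : ∀ θ ∈ Set.Icc (![Ulo', slo', nlo'] : Fin 3 → ℝ) ![Uhi', shi', nhi'],
      L ≤ energyDensityTT' 1 (θ 1) (θ 0) (θ 2))
    {Ua V ℓ : ℝ} (hUa0 : 0 ≤ Ua) (hUa : Ulo' ≤ Ua ∧ Ua ≤ Uhi')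
    (hS' : slo' ≤ ((eS.encl.fst : ℚ) : ℝ) ∧ ((eS.encl.snd : ℚ) : ℝ) ≤ shi')
    (hN' : nlo' ≤ ((eN.encl.fst : ℚ) : ℝ) ∧ ((eN.encl.snd : ℚ) : ℝ) ≤ nhi') (hV : 0 ≤ V)
    (hUaU : Ua + ((max |eSS.encl.fst| |eSS.encl.snd| : ℚ) : ℝ) * V ≤ ((eU.encl.fst : ℚ) : ℝ))
    (hℓ : ∀ n : ℝ, eN.Mem n → ℓ ≤ energyDensityTT' 1 0 V n) (hℓ0 : ℓ ≤ 0) :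
    HoldsOn (fun p : OneBandCoord → ℝ =>
      L + ((max |eSS.encl.fst| |eSS.encl.snd| : ℚ) : ℝ) * ℓ ≤
        (hubbardTT'T''FermionInteraction 1 (p .tpOverT) (p .tppOverT) (p .UOverT)).tiGroundEnergyDensityAt
          2 (p .filling)) B := by
  intro p hp
  obtain ⟨hu1, -, hs1, hs2, hn1, hn2, hss⟩ := mem_coords_of_mem hU hS hSS hN hp
  have hN0' : (0 : ℝ) < ((eN.encl.fst : ℚ) : ℝ) := by exact_mod_cast hN0
  have hN2' : ((eN.encl.snd : ℚ) : ℝ) < 2 := by exact_mod_cast hN2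
  have hn0 : 0 < p .filling := lt_of_lt_of_le hN0' hn1
  have hn2' : p .filling < 2 := lt_of_le_of_lt hn2 hN2'
  have hmem : (![Ua, p .tpOverT, p .filling] : Fin 3 → ℝ) ∈
      Set.Icc (![Ulo', slo', nlo'] : Fin 3 → ℝ) ![Uhi', shi', nhi'] :=
    mem_Icc_vec3_iff.2 ⟨⟨hUa.1, hUa.2⟩, ⟨hS'.1.trans hs1, hs2.trans hS'.2⟩, ⟨hN'.1.trans hn1, hn2.trans hN'.2⟩⟩
  have hθ := hL _ hmem
  have e0 : (![Ua, p .tpOverT, p .filling] : Fin 3 → ℝ) 0 = Ua := rfl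
  have e1 : (![Ua, p .tpOverT, p .filling] : Fin 3 → ℝ) 1 = p .tpOverT := rfl
  have e2 : (![Ua, p .tpOverT, p .filling] : Fin 3 → ℝ) 2 = p .filling := rfl
  rw [e0, e1, e2] at hθ
  exact le_tpp_of_anchorFloor_diagU_of_abs_le 1 (p .tpOverT) hss hUa0 hV (hUaU.trans hu1) hn0 hn2' hθ
    (hℓ _ (hp _ _ hN)) hℓ0

/-- **THE DRESSED `t''` CAP SEAM.** Let `B` carry entries `eU, eS, eSS, eN` with `eU.lo ≥ 0`, `0 < eN.lo`, `eN.hi < 2`,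
`m = max |eSS.lo| |eSS.hi|`. Let the box's OWN S2 cap hold, `∀ θ ∈ Set.Icc (s2Lo eU eS eN) (s2Hi eU eS eN),
energyDensityTT' 1 (θ 1) (θ 0) (θ 2) ≤ R`; let `D` be a double-occupancy ceiling for every torus-limit ground state at every
point of that cell (the `docc` word shape); and let `ℓ' ≤ e(1, 0, V', n)` at every filling of the box, `V' ≥ 0`, `0 ≤ V'·D − ℓ'`.
Then on `B`: `e_{p n}(1, p tp/t, p tpp/t, p U/t) ≤ R + m·(V'·D − ℓ')`. [cite: Griffiths1966, §II] -/
theorem holdsOn_tpp_cap_of_docc_diagU {B : OneBandBox} {eU eS eSS eN : Entry}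
    (hU : B .UOverT = some eU) (hS : B .tpOverT = some eS) (hSS : B .tppOverT = some eSS)
    (hN : B .filling = some eN) (hU0 : 0 ≤ eU.encl.fst) (hN0 : 0 < eN.encl.fst) (hN2 : eN.encl.snd < 2)
    {R : ℝ} (hR : ∀ θ ∈ Set.Icc (s2Lo eU eS eN) (s2Hi eU eS eN), energyDensityTT' 1 (θ 1) (θ 0) (θ 2) ≤ R)
    {D : ℝ}
    (hD : ∀ θ ∈ Set.Icc (s2Lo eU eS eN) (s2Hi eU eS eN),
      ∀ (ω : InfVolFermionState 2) (Ls : ℕ → ℕ) (ψ : ∀ L, Fock (Orb (FermionTorus 2 L))),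
      Tendsto Ls atTop atTop →
      (∀ j, IsGroundStateInSector (hubbardTorusTT' (Ls j) 1 (θ 1) (θ 0)) (rectN (θ 2) (Ls j)) 0 (ψ (Ls j))) →
      (∀ j, star (ψ (Ls j)) ⬝ᵥ ψ (Ls j) = 1) → ω.IsTorusLimitOf ψ Ls →
      ω.meanEnergy (hubbardTTPrimeFermionInteraction 0 0 1) 1 ≤ D)
    {V' ℓ' : ℝ} (hV' : 0 ≤ V') (hℓ' : ∀ n : ℝ, eN.Mem n → ℓ' ≤ energyDensityTT' 1 0 V' n)
    (hDℓ' : 0 ≤ V' * D - ℓ') :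
    HoldsOn (fun p : OneBandCoord → ℝ =>
      (hubbardTT'T''FermionInteraction 1 (p .tpOverT) (p .tppOverT) (p .UOverT)).tiGroundEnergyDensityAt
          2 (p .filling) ≤
        R + ((max |eSS.encl.fst| |eSS.encl.snd| : ℚ) : ℝ) * (V' * D - ℓ')) B := by
  intro p hp
  obtain ⟨hu1, -, -, -, hn1, hn2, hss⟩ := mem_coords_of_mem hU hS hSS hN hp
  have hU0' : (0 : ℝ) ≤ ((eU.encl.fst : ℚ) : ℝ) := by exact_mod_cast hU0
  have hN0' : (0 : ℝ) < ((eN.encl.fst : ℚ) : ℝ) := by exact_mod_cast hN0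
  have hN2' : ((eN.encl.snd : ℚ) : ℝ) < 2 := by exact_mod_cast hN2
  have hu0 : 0 ≤ p .UOverT := hU0'.trans hu1
  have hn0 : 0 < p .filling := lt_of_lt_of_le hN0' hn1
  have hn2' : p .filling < 2 := lt_of_le_of_lt hn2 hN2'
  have hθ := s2Coords_mem_Icc hU hS hN hp
  have hRp := hR _ hθ
  have hDp := hD _ hθ
  have h1 : s2Coords p 1 = p .tpOverT := rfl
  have h0 : s2Coords p 0 = p .UOverT := rfl
  have h2 : s2Coords p 2 = p .filling := rfl
  rw [h1, h0, h2] at hRp hDp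
  exact tpp_le_cap_add_mul_diagU_of_abs_le 1 (p .tpOverT) hss hu0 hn0 hn2' hRp hDp hV'
    (hℓ' _ (hp _ _ hN)) hDℓ'

/-- **THE DRESSED OBJECT-M WINDOW** (both seams at once): with the data of `holdsOn_tpp_floor_of_anchorCell_diagU` and
`holdsOn_tpp_cap_of_docc_diagU`, on `B`: `L + m·ℓ ≤ e_{p n}(1, p tp/t, p tpp/t, p U/t) ≤ R + m·(V'·D − ℓ')`,
`m = max |eSS.lo| |eSS.hi|` — the replacement of `holdsOn_tiGroundEnergyDensityAt_objectM_kinematic`'s `[L − 1.62m, R + 1.62m]`.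
[cite: Ruelle1969, §3.4] [cite: Griffiths1966, §II] -/
theorem holdsOn_tpp_window_diagU {B : OneBandBox} {eU eS eSS eN : Entry}
    (hU : B .UOverT = some eU) (hS : B .tpOverT = some eS) (hSS : B .tppOverT = some eSS)
    (hN : B .filling = some eN) (hU0 : 0 ≤ eU.encl.fst) (hN0 : 0 < eN.encl.fst) (hN2 : eN.encl.snd < 2)
    {Ulo' slo' nlo' Uhi' shi' nhi' L : ℝ}
    (hL : ∀ θ ∈ Set.Icc (![Ulo', slo', nlo'] : Fin 3 → ℝ) ![Uhi', shi', nhi'],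
      L ≤ energyDensityTT' 1 (θ 1) (θ 0) (θ 2))
    {Ua V ℓ : ℝ} (hUa0 : 0 ≤ Ua) (hUa : Ulo' ≤ Ua ∧ Ua ≤ Uhi')
    (hS' : slo' ≤ ((eS.encl.fst : ℚ) : ℝ) ∧ ((eS.encl.snd : ℚ) : ℝ) ≤ shi')
    (hN' : nlo' ≤ ((eN.encl.fst : ℚ) : ℝ) ∧ ((eN.encl.snd : ℚ) : ℝ) ≤ nhi') (hV : 0 ≤ V)
    (hUaU : Ua + ((max |eSS.encl.fst| |eSS.encl.snd| : ℚ) : ℝ) * V ≤ ((eU.encl.fst : ℚ) : ℝ))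
    (hℓ : ∀ n : ℝ, eN.Mem n → ℓ ≤ energyDensityTT' 1 0 V n) (hℓ0 : ℓ ≤ 0)
    {R : ℝ} (hR : ∀ θ ∈ Set.Icc (s2Lo eU eS eN) (s2Hi eU eS eN), energyDensityTT' 1 (θ 1) (θ 0) (θ 2) ≤ R)
    {D : ℝ}
    (hD : ∀ θ ∈ Set.Icc (s2Lo eU eS eN) (s2Hi eU eS eN),
      ∀ (ω : InfVolFermionState 2) (Ls : ℕ → ℕ) (ψ : ∀ L, Fock (Orb (FermionTorus 2 L))),
      Tendsto Ls atTop atTop →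
      (∀ j, IsGroundStateInSector (hubbardTorusTT' (Ls j) 1 (θ 1) (θ 0)) (rectN (θ 2) (Ls j)) 0 (ψ (Ls j))) →
      (∀ j, star (ψ (Ls j)) ⬝ᵥ ψ (Ls j) = 1) → ω.IsTorusLimitOf ψ Ls →
      ω.meanEnergy (hubbardTTPrimeFermionInteraction 0 0 1) 1 ≤ D)
    {V' ℓ' : ℝ} (hV' : 0 ≤ V') (hℓ' : ∀ n : ℝ, eN.Mem n → ℓ' ≤ energyDensityTT' 1 0 V' n)
    (hDℓ' : 0 ≤ V' * D - ℓ') :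
    HoldsOn (fun p : OneBandCoord → ℝ =>
      L + ((max |eSS.encl.fst| |eSS.encl.snd| : ℚ) : ℝ) * ℓ ≤
          (hubbardTT'T''FermionInteraction 1 (p .tpOverT) (p .tppOverT) (p .UOverT)).tiGroundEnergyDensityAt
            2 (p .filling) ∧
        (hubbardTT'T''FermionInteraction 1 (p .tpOverT) (p .tppOverT) (p .UOverT)).tiGroundEnergyDensityAt
            2 (p .filling) ≤
          R + ((max |eSS.encl.fst| |eSS.encl.snd| : ℚ) : ℝ) * (V' * D - ℓ')) B :=
  holdsOn_and_iff.2
    ⟨holdsOn_tpp_floor_of_anchorCell_diagU hU hS hSS hN hN0 hN2 hL hUa0 hUa hS' hN' hV hUaU hℓ hℓ0,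
      holdsOn_tpp_cap_of_docc_diagU hU hS hSS hN hU0 hN0 hN2 hR hD hV' hℓ' hDℓ'⟩

/-- **The floor seam fed by a full S2 `_word_Icc` window on the source cell** (both sides stated, only the floor used):
convenience form for the cell words of record. [cite: Ruelle1969, §3.4] -/
theorem holdsOn_tpp_floor_of_anchorCellWord_diagU {B : OneBandBox} {eU eS eSS eN : Entry}
    (hU : B .UOverT = some eU) (hS : B .tpOverT = some eS) (hSS : B .tppOverT = some eSS)
    (hN : B .filling = some eN) (hN0 : 0 < eN.encl.fst) (hN2 : eN.encl.snd < 2)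
    {Ulo' slo' nlo' Uhi' shi' nhi' L R' : ℝ}
    (hW : ∀ θ ∈ Set.Icc (![Ulo', slo', nlo'] : Fin 3 → ℝ) ![Uhi', shi', nhi'],
      L ≤ energyDensityTT' 1 (θ 1) (θ 0) (θ 2) ∧ energyDensityTT' 1 (θ 1) (θ 0) (θ 2) ≤ R')
    {Ua V ℓ : ℝ} (hUa0 : 0 ≤ Ua) (hUa : Ulo' ≤ Ua ∧ Ua ≤ Uhi')
    (hS' : slo' ≤ ((eS.encl.fst : ℚ) : ℝ) ∧ ((eS.encl.snd : ℚ) : ℝ) ≤ shi')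
    (hN' : nlo' ≤ ((eN.encl.fst : ℚ) : ℝ) ∧ ((eN.encl.snd : ℚ) : ℝ) ≤ nhi') (hV : 0 ≤ V)
    (hUaU : Ua + ((max |eSS.encl.fst| |eSS.encl.snd| : ℚ) : ℝ) * V ≤ ((eU.encl.fst : ℚ) : ℝ))
    (hℓ : ∀ n : ℝ, eN.Mem n → ℓ ≤ energyDensityTT' 1 0 V n) (hℓ0 : ℓ ≤ 0) :
    HoldsOn (fun p : OneBandCoord → ℝ =>
      L + ((max |eSS.encl.fst| |eSS.encl.snd| : ℚ) : ℝ) * ℓ ≤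
        (hubbardTT'T''FermionInteraction 1 (p .tpOverT) (p .tppOverT) (p .UOverT)).tiGroundEnergyDensityAt
          2 (p .filling)) B :=
  holdsOn_tpp_floor_of_anchorCell_diagU hU hS hSS hN hN0 hN2 (fun θ hθ => (hW θ hθ).1) hUa0 hUa hS' hN' hV
    hUaU hℓ hℓ0

end Summit.Ventures.CertifiedManyBodySolver.Downfold

end
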